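import Literature.AnabelianGeometry.EtaleTheta.GalSectCuspidalTorsors
import Literature.AnabelianGeometry.EtaleTheta.ThetaRootOrbits
import HarnessLib

/-!
# [GalSect] §4 / Def. 4.1 for an abstract cuspidal pair `(D, I)`, and [EtTh] Cor. 2.8 (ii), Rmk. 2.9.2
# typed over it (cusps of `X̲̲`, `X̲`, `C̲̲`, `C̲`)

Mochizuki, *Galois sections in absolute anabelian geometry* [GalSect], Nagoya Math. J. **179** (2005),
§4 p.33 and Def. 4.1 (i)(ii) pp.33–34 [cite: MochizukiGalSect2005, Def 4.1 p.33]; Mochizuki, *The étale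
theta function …* [EtTh], Publ. RIMS **45** (2009), Cor. 2.8 (ii) p.268 (PRIMS PDF p.42) and Rmk. 2.9.2
p.269 (PDF p.43) [cite: MochizukiEtTh2009, Cor 2.8 (ii) p.42].  abc-iut cell, layer L2, ROW (B)
«EtTh:Cor2.8(ii) + Rmk 2.9.2 TYPED» (abc-iut-L2-lead gen 3, RULINGS/ROWS #1 (R3), 2026-08-26T04:01:23Z;
seat abc-iut-w5-d062 gen 2).  STATEMENTS-FIRST (review lane); definitional parts proved; no named fact.

**[EtTh] Cor. 2.8 (ii) (verbatim, p.268).** "Suppose further that the cusps of `X̲_□` are rational over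
`K_□`, that the residue characteristic of `K_□` is prime to `l`, and that `K_□` contains a primitive `l`-th
root of unity. Then the `{±1}`-[i.e., `μ₂`-] structure of Theorem 1.10, (iii), determines a `μ_{2l}`
(respectively, `μ₂`; `μ_{2l}`; `μ₂`)-structure [cf. [Mzk13], Corollary 4.12] on the `(K^×_□)^∧`-torsor at
the cusps of `X̲̲^log_□` (respectively, `X̲^log_□`; `C̲̲^log_□`; `C̲^log_□`). Moreover, this `μ_{2l}`
(respectively, `μ₂`; `μ_{2l}`; `μ₂`)-structure is compatible with the canonical integral structure [cf.
[Mzk13], Definition 4.1, (iii)] determined by the stable model of `X^log_□` and preserved by `γ`."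
**Rmk. 2.9.2 (verbatim, p.269).** "In the situation of Corollary 2.8, (ii), we make the following
observation, relative to the labels of Corollary 2.9: The `2l` (respectively, `2`) trivializations of
the `(K^×_□)^∧`-torsor at a cusp labeled `0` (respectively, an arbitrary cusp) of `X̲̲^log_□` (respectively,
`X̲^log_□`) determined by the `μ_{2l}` (respectively, `μ₂`)-structure under discussion are permuted
transitively by the subgroup of `Aut_K(X̲̲^log_□)` (respectively, `Aut_K(X̲^log_□)`) [cf. Remarks 2.1.1,
2.6.1, 2.9.1] that stabilizes the cusp. In the case of `X̲̲^log_□`, at cusps with nonzero labels, the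
subgroup of the corresponding '`Aut_K(−)`' that stabilizes the cusp permutes the `2l` trivializations
under consideration via the action of `μ_l` [hence has precisely two orbits]."  (Decorations read on the
kurims render as recorded by abc-iut-L2-t2 in `ThetaRootOrbits.lean`: double underline `X̲̲`, single `X̲`.)

## How it is typed (read with the referee)

* WHY A SECOND CARRIER.  ROW (A) (`GalSectCuspidalTorsors.lean`) types [GalSect] §4 at a cusp of a curve
  of L3's `SemiGraphs.TemperedCurve p` (base field `K ⊆ ℚ̄_p`, structure group the real `(K^×)^∧`).
  Cor. 2.8 (ii) concerns the cusps of the COVERINGS `X̲̲, X̲, C̲̲, C̲` of abc-iut-L2-t2's §2 interface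
  `ThetaCovers.TemperedCoverData l` (tempered `Π^tp_C = T.Gtp`, tower `Π^tp_Z = T.tp (…)`, ABSTRACT
  `T.GK`, no base field): a cusp `z` of a member `Z` is visible only as `D_z = Π^tp_Z ∩ g·D·g⁻¹`
  (`D = T.cuspStabC`, Cor. 2.9) with `I_z = D_z ∩ Δ^tp_C`.  Hence [GalSect] §4 / Def. 4.1 (i)(ii) is
  re-done for an ABSTRACT cuspidal pair `P = (D, I ⊴ D)` (`GalSect.CuspPair`), structure group an
  abstract group `A` ("`(K^×_□)^∧ ≅ H¹(G_K, Ẑ(1))`") with subgroups "`μ_n(K)`"; ROW (A)'s notions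
  are the case `P = (D_x, I_x)` (`splittings_cuspPairOf`, rfl).
* REAL: splittings, `D`-conjugates of splittings (PROVED), `I`-conjugacy classes, transport along
  isomorphisms of topological groups (PROVED), orbit structures.  DATA (`Cor28iiData`, never asserted to
  exist): the free transitive `A`-action at each cusp, the canonical integral structure at each cusp
  (Def. 4.1 (iii), "determined by the stable model"), `μ_n ≤ A`; FLAG without carrier: "residue
  characteristic prime to `l`" (certified only by an origin predicate, like L3's `HasStableReduction`);
  "`K ∋ μ_l`" = t2's `T.HasMuL`; "cusps rational" = `D_z ↠ G_K`.
* Cor. 2.8 (ii) in t2's ONE-OBJECT form (as `Cor28_i`): `γ` = an automorphism `Γ` of `Π^tp_C` stabilising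
  the member's Prop. 2.4 list; "determines … preserved by `γ`" = EXISTENCE of a `μ_n`-structure inside
  the canonical integral structure at every rational cusp, TRANSPORTED by every such `Γ` to the structure
  at the image cusp.  Rmk. 2.9.2: the LABEL MAP of Cor. 2.9 enters as a PARAMETER `label0` (TODO-merge).

READING NOTE (R4): t2's `cuspStabC` is the decomposition group of the cusp of the orbicurve `C`; the
cusps of a member `Z` (`Π^tp_Z = S`) are the double cosets `S \ Π^tp_C / cuspStabC` (t2's `cuspOrbits`).
v2 (13:00Z window, G-w5d062-2): `Cor28iiData` carries `units` ("`O_K^×`"), `mu_le`, and the LAW that each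
canonical integral structure is a `units`-structure (Def. 4.1 (iii); audit F-w5d016-g3-1).  HONEST FRAMING:
[GalSect], [EtTh] refereed; nothing printed is asserted; typed ≠ proved; no side on [IUTchIII] Cor. 3.12.
-/

noncomputable section

open scoped Pointwise

namespace Literature.AnabelianGeometry.EtaleTheta

open Literature.AnabelianGeometry.SemiGraphs

namespace GalSect

/-- `d · D · d⁻¹ = D` for `d ∈ D`. [cite: MochizukiGalSect2005, §4 p.33] -/
theorem conj_smul_eq_self_of_mem {G : Type*} [Group G] {D : Subgroup G} {d : G} (hd : d ∈ D) :
    MulAut.conj d • D = D := by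
  ext y
  rw [Subgroup.mem_smul_pointwise_iff_exists]
  constructor
  · rintro ⟨z, hz, rfl⟩
    rw [MulAut.smul_def, MulAut.conj_apply]
    exact D.mul_mem (D.mul_mem hd hz) (D.inv_mem hd)
  · intro hy
    refine ⟨d⁻¹ * y * d, D.mul_mem (D.mul_mem (D.inv_mem hd) hy) hd, ?_⟩
    rw [MulAut.smul_def, MulAut.conj_apply]
    group

/-- `d · N · d⁻¹ = N` for a normal subgroup `N`. [cite: MochizukiGalSect2005, §4 p.33] -/
theorem conj_smul_eq_self_of_normal {G : Type*} [Group G] (N : Subgroup G) [hN : N.Normal] (d : G) :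
    MulAut.conj d • N = N := by
  ext y
  rw [Subgroup.mem_smul_pointwise_iff_exists]
  constructor
  · rintro ⟨z, hz, rfl⟩
    rw [MulAut.smul_def, MulAut.conj_apply]
    exact hN.conj_mem z hz d
  · intro hy
    refine ⟨d⁻¹ * y * d, ?_, by rw [MulAut.smul_def, MulAut.conj_apply]; group⟩
    simpa only [inv_inv, mul_assoc] using hN.conj_mem y hy d⁻¹

/-! ### [GalSect] §4 for an abstract cuspidal pair `(D, I)` -/

/-- An abstract **cuspidal pair** in a topological group: a "decomposition group" `D` with a normal
"inertia" subgroup `I ⊴ D` ("`1 → I_x → D_x → G_K → 1`", [GalSect] §4 p.33, with `G_K := D/I`).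
[cite: MochizukiGalSect2005, §4 p.33] -/
structure CuspPair (G : Type*) [Group G] [TopologicalSpace G] where
  /-- the decomposition group `D` -/
  D : Subgroup G
  /-- the inertia group `I` -/
  I : Subgroup G
  /-- `I ≤ D` -/
  I_le : I ≤ D
  /-- `I` is normalised by `D` -/
  conj_I : ∀ d ∈ D, MulAut.conj d • I = I

namespace CuspPair

variable {G : Type*} [Group G] [TopologicalSpace G] (P : CuspPair G)

/-- The **splittings** of `1 → I → D → D/I → 1`, recorded by their images: closed `S ≤ D` with
`S ∩ I = 1`, `S · I = D` ([GalSect] §4 p.33). [cite: MochizukiGalSect2005, §4 p.33] -/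
def splittings : Set (Subgroup G) :=
  {S | IsClosed (S : Set G) ∧ S ≤ P.D ∧ S ⊓ P.I = ⊥ ∧ S ⊔ P.I = P.D}

/-- Conjugation by `d ∈ D` fixes `D`. [cite: MochizukiGalSect2005, §4 p.33] -/
theorem conj_D_eq {d : G} (hd : d ∈ P.D) : MulAut.conj d • P.D = P.D :=
  conj_smul_eq_self_of_mem hd

/-- **Conjugation by `D` permutes the splittings** (so `I` acts on them) — PROVED.
[cite: MochizukiGalSect2005, §4 p.33] -/
theorem conj_mem_splittings [IsTopologicalGroup G] {d : G} (hd : d ∈ P.D) {S : Subgroup G}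
    (hS : S ∈ P.splittings) :
    MulAut.conj d • S ∈ P.splittings := by
  obtain ⟨hcl, hle, hinf, hsup⟩ := hS
  refine ⟨?_, ?_, ?_, ?_⟩
  · have : ((MulAut.conj d • S : Subgroup G) : Set G) = (fun y => d * y * d⁻¹) '' (S : Set G) := by
      ext y
      simp only [Subgroup.coe_pointwise_smul, Set.mem_smul_set, Set.mem_image, SetLike.mem_coe,
        MulAut.smul_def, MulAut.conj_apply]
    rw [this]
    exact (Homeomorph.mulRight d⁻¹ |>.isClosedMap) _
      ((Homeomorph.mulLeft d |>.isClosedMap) _ hcl) |> fun h => by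
        simpa only [Set.image_image, Homeomorph.coe_mulLeft, Homeomorph.coe_mulRight] using h
  · calc MulAut.conj d • S ≤ MulAut.conj d • P.D := Subgroup.pointwise_smul_le_pointwise_smul_iff.mpr hle
      _ = P.D := P.conj_D_eq hd
  · rw [← P.conj_I d hd, ← Subgroup.smul_inf, hinf, Subgroup.smul_bot]
  · rw [← P.conj_I d hd, ← Subgroup.smul_sup, hsup, P.conj_D_eq hd]

/-- Two splittings are `I`-conjugate. [cite: MochizukiGalSect2005, §4 p.33] -/
def InertiaConj (S T : Subgroup G) : Prop := ∃ i ∈ P.I, T = MulAut.conj i • S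

/-- `I`-conjugacy is an equivalence relation — PROVED. [cite: MochizukiGalSect2005, §4 p.33] -/
theorem inertiaConj_equivalence : Equivalence P.InertiaConj where
  refl S := ⟨1, P.I.one_mem, by simp⟩
  symm := by rintro S T ⟨i, hi, rfl⟩; exact ⟨i⁻¹, P.I.inv_mem hi, by rw [map_inv, inv_smul_smul]⟩
  trans := by
    rintro S T U ⟨i, hi, rfl⟩ ⟨j, hj, rfl⟩; exact ⟨j * i, P.I.mul_mem hj hi, by rw [map_mul, mul_smul]⟩

/-- The setoid of `I`-conjugacy on splittings. [cite: MochizukiGalSect2005, §4 p.33] -/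
def splittingSetoid : Setoid P.splittings where
  r S T := P.InertiaConj S.1 T.1
  iseqv := ⟨fun S => P.inertiaConj_equivalence.refl S.1, fun h => P.inertiaConj_equivalence.symm h,
    fun h₁ h₂ => P.inertiaConj_equivalence.trans h₁ h₂⟩

/-- **The torsor set at the cusp**: splittings modulo `I`-conjugation ("whose splittings form a torsor over
`H¹(G_K, Ẑ(1))`", [GalSect] §4 p.33; READING NOTE R1 of ROW (A)). [cite: MochizukiGalSect2005, §4 p.33] -/
def SplittingClass : Type _ := Quotient P.splittingSetoid

/-- The class of a splitting. [cite: MochizukiGalSect2005, §4 p.33] -/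
def SplittingClass.mk (S : Subgroup G) (hS : S ∈ P.splittings) : P.SplittingClass :=
  Quotient.mk P.splittingSetoid ⟨S, hS⟩

/-- Every class has a representative — PROVED. [cite: MochizukiGalSect2005, §4 p.33] -/
theorem SplittingClass.exists_rep (c : P.SplittingClass) :
    ∃ (S : Subgroup G) (hS : S ∈ P.splittings), SplittingClass.mk P S hS = c := by
  induction c using Quotient.inductionOn with
  | h S => exact ⟨S.1, S.2, rfl⟩

/-- The splitting subgroups whose class lies in `R` (Rmk. 2.9.2's "trivializations" of a structure).
[cite: MochizukiEtTh2009, Rmk 2.9.2 p.43] -/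
def members (R : Set P.SplittingClass) : Set (Subgroup G) :=
  {S | ∃ hS : S ∈ P.splittings, SplittingClass.mk P S hS ∈ R}

/-! #### The torsor structure and Def. 4.1 (i)(ii)-type structures (structure group abstract) -/

/-- **The torsor structure at the cusp** ([GalSect] §4 p.33), structure group an ABSTRACT group `A`
(= `(K^×)^∧ ≅ H¹(G_K, Ẑ(1))`; real in ROW (A)): a free transitive `A`-action on classes.  DATA.
[cite: MochizukiGalSect2005, §4 p.33] -/
structure TorsorData (A : Type*) [Group A] where
  /-- the action of `A` on splitting classes -/
  act : A → P.SplittingClass → P.SplittingClass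
  /-- `1` acts trivially -/
  act_one : ∀ c, act 1 c = c
  /-- multiplicativity -/
  act_mul : ∀ a b c, act (a * b) c = act a (act b c)
  /-- free and transitive -/
  existsUnique_act_eq : ∀ c c', ∃! a, act a c = c'

/-- **Def. 4.1 (i)/(ii)-shape**: a `B`-torsor structure on the torsor of splitting classes, `B ≤ A` — a
`B`-orbit (integral: `B = O_K^×`; discrete: `B = K^×`; Cor. 4.12 / Cor. 2.8 (ii): `B = μ_n(K)`).
[cite: MochizukiGalSect2005, Def 4.1 (ii) p.34] -/
def TorsorData.IsStructure {P : CuspPair G} {A : Type*} [Group A] (T : P.TorsorData A)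
    (B : Subgroup A) (R : Set P.SplittingClass) : Prop :=
  ∃ c ∈ R, R = {c' | ∃ b ∈ B, c' = T.act b c}

/-- A `μ`-structure **compatible with** a given (canonical integral) structure `Rcan`: a `μ`-orbit inside
it ("an even finer reduction of structure group", [GalSect] p.43). [cite: MochizukiGalSect2005, Cor 4.12 p.43] -/
def TorsorData.IsSubStructure {P : CuspPair G} {A : Type*} [Group A] (T : P.TorsorData A)
    (μ : Subgroup A) (Rcan R : Set P.SplittingClass) : Prop :=
  T.IsStructure μ R ∧ R ⊆ Rcan

/-! #### Transport along isomorphisms of topological groups ("preserved by `γ`") -/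

/-- The image pair under `Γ : G ≃ G'`. [cite: MochizukiEtTh2009, Cor 2.8 (ii) p.42] -/
def map {G' : Type*} [Group G'] [TopologicalSpace G'] (Γ : G ≃ₜ* G') : CuspPair G' where
  D := P.D.map Γ.toMulEquiv.toMonoidHom
  I := P.I.map Γ.toMulEquiv.toMonoidHom
  I_le := Subgroup.map_mono P.I_le
  conj_I := by
    rintro _ ⟨d, hd, rfl⟩
    have key : MulAut.conj (Γ.toMulEquiv.toMonoidHom d) • P.I.map Γ.toMulEquiv.toMonoidHom =
        (MulAut.conj d • P.I).map Γ.toMulEquiv.toMonoidHom := by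
      ext y
      simp only [Subgroup.mem_smul_pointwise_iff_exists, Subgroup.mem_map, MulAut.smul_def,
        MulAut.conj_apply, MulEquiv.toMonoidHom_eq_coe, MonoidHom.coe_coe]
      constructor
      · rintro ⟨_, ⟨i, hi, rfl⟩, rfl⟩
        exact ⟨d * i * d⁻¹, ⟨i, hi, rfl⟩, by simp⟩
      · rintro ⟨_, ⟨i, hi, rfl⟩, rfl⟩
        exact ⟨Γ.toMulEquiv i, ⟨i, hi, rfl⟩, by simp⟩
    rw [key, P.conj_I d hd]

/-- **Transport of splittings**: `Γ` carries splittings of `P` to splittings of `Γ(P)` — PROVED.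
[cite: MochizukiEtTh2009, Cor 2.8 (ii) p.42] -/
theorem map_mem_splittings {G' : Type*} [Group G'] [TopologicalSpace G'] (Γ : G ≃ₜ* G')
    {S : Subgroup G} (hS : S ∈ P.splittings) :
    S.map Γ.toMulEquiv.toMonoidHom ∈ (P.map Γ).splittings := by
  obtain ⟨hcl, hle, hinf, hsup⟩ := hS
  have hinj : Function.Injective Γ.toMulEquiv.toMonoidHom := Γ.toMulEquiv.injective
  refine ⟨?_, Subgroup.map_mono hle, ?_, ?_⟩
  · change IsClosed (Γ.toMulEquiv.toMonoidHom '' (S : Set G))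
    exact Γ.toHomeomorph.isClosedMap _ hcl
  · change S.map _ ⊓ P.I.map _ = ⊥
    rw [← Subgroup.map_inf _ _ _ hinj, hinf, Subgroup.map_bot]
  · change S.map _ ⊔ P.I.map _ = P.D.map _
    rw [← Subgroup.map_sup, hsup]

/-- "**preserved by `γ`**" for structures at two cuspidal pairs matched by `Γ` (`Γ(P) = P'`): `Γ` carries
the member splittings of `R` onto those of `R'`. [cite: MochizukiEtTh2009, Cor 2.8 (ii) p.42] -/
def PreservedBy {G' : Type*} [Group G'] [TopologicalSpace G'] (P' : CuspPair G') (Γ : G ≃ₜ* G')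
    (R : Set P.SplittingClass) (R' : Set P'.SplittingClass) : Prop :=
  P.D.map Γ.toMulEquiv.toMonoidHom = P'.D ∧
    (fun S => S.map Γ.toMulEquiv.toMonoidHom) '' P.members R = P'.members R'

end CuspPair

/-! #### ROW (A)'s notions are the case `P = (D_x, I_x)` -/

/-- The cuspidal pair `(D_x, I_x)` of a cusp `x` of a curve of L3's interface.
[cite: MochizukiGalSect2005, §4 p.33] -/
def cuspPairOf {p : ℕ} [Fact p.Prime] (X : TemperedCurve p) (x : X.Pt) : CuspPair X.PiTemp where
  D := X.decomp x
  I := X.inertia x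
  I_le := inf_le_left
  conj_I _ hd := conj_inertia_eq X x hd

/-- ROW (A)'s `splittings X x` ARE the splittings of the pair `(D_x, I_x)` (definitional).
[cite: MochizukiGalSect2005, §4 p.33] -/
theorem splittings_cuspPairOf {p : ℕ} [Fact p.Prime] (X : TemperedCurve p) (x : X.Pt) :
    (cuspPairOf X x).splittings = splittings X x :=
  rfl

end GalSect

/-! ### [EtTh] Cor. 2.8 (ii) and Rmk. 2.9.2 over abc-iut-L2-t2's §2 interface -/

namespace ThetaCovers

namespace TemperedCoverData

universe u

variable {l : ℕ} (T : TemperedCoverData.{u} l)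

/-- `Δ^tp_C = Ker(Π^tp_C → G_K)` (t2 writes it inline). [cite: MochizukiEtTh2009, Def 2.3 p.38] -/
abbrev DeltaTp : Subgroup T.Gtp := (T.aug.comp T.toHat).ker

/-- **The cuspidal pair of the cusp `g` of the member `Z` with `Π^tp_Z = S`** (READING NOTE R4):
`D_z = S ∩ g·D_C·g⁻¹` (`D_C = T.cuspStabC`, the decomposition group of the cusp of `C`) and
`I_z = D_z ∩ Δ^tp_C`. [cite: MochizukiEtTh2009, Cor 2.8 (ii) p.42] -/
def cuspPairAt (S : Subgroup T.Gtp) (g : T.Gtp) : GalSect.CuspPair T.Gtp where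
  D := S ⊓ MulAut.conj g • T.cuspStabC
  I := (S ⊓ MulAut.conj g • T.cuspStabC) ⊓ T.DeltaTp
  I_le := inf_le_left
  conj_I d hd := by
    haveI : (T.DeltaTp).Normal := inferInstanceAs (T.aug.comp T.toHat).ker.Normal
    rw [Subgroup.smul_inf, GalSect.conj_smul_eq_self_of_mem hd,
      GalSect.conj_smul_eq_self_of_normal T.DeltaTp d]

/-- The cusp `g` of the member `Z` (`Π^tp_Z = S`) is **`K`-rational**: `D_z ↠ G_K` ("the cusps … are
rational over `K_□`", Cor. 2.8 (ii)). [cite: MochizukiEtTh2009, Cor 2.8 (ii) p.42] -/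
def IsRationalCusp (S : Subgroup T.Gtp) (g : T.Gtp) : Prop :=
  Function.Surjective ((T.aug.comp T.toHat).restrict (T.cuspPairAt S g).D)

/-- The **cusp stabiliser in `Aut_K(Z)`** `= N_{Π^tp_C}(S)/S` (t2's `autK`), through representatives:
`n ∈ N(S)` stabilises the cusp `g` iff it fixes the double coset `S·g·D_C`, i.e. `n·D_z·n⁻¹ = s·D_z·s⁻¹`
for some `s ∈ S` (Rmk. 2.9.2 "the subgroup of `Aut_K(−)` that stabilizes the cusp").
[cite: MochizukiEtTh2009, Rmk 2.9.2 p.43] -/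
def cuspStabilizerReps (S : Subgroup T.Gtp) (g : T.Gtp) : Set T.Gtp :=
  {n | n ∈ Subgroup.normalizer (S : Set T.Gtp) ∧
    ∃ s ∈ S, MulAut.conj n • (T.cuspPairAt S g).D = MulAut.conj s • (T.cuspPairAt S g).D}

/-- A stabiliser representative `n` with `n·D_z·n⁻¹ = s·D_z·s⁻¹` acts on splittings by conjugation by
`s⁻¹·n` (which normalises `D_z`). [cite: MochizukiEtTh2009, Rmk 2.9.2 p.43] -/
def stabAct (n s : T.Gtp) (S₀ : Subgroup T.Gtp) : Subgroup T.Gtp := MulAut.conj (s⁻¹ * n) • S₀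

/-- **The data of Cor. 2.8 (ii)** for the member `Z` of the tower with `Π^tp_Z = S` (hypothesis structure;
DATA + carrier-free FLAGS, never asserted to exist): the structure group "`(K^×)^∧`" as an abstract
group `A` with its subgroups "`μ_n(K)`", at every cusp `g` the torsor structure ([GalSect] §4)
and the canonical integral structure ([GalSect] Def. 4.1 (iii), "determined by the stable model of
`X^log`"), and the flag "residue characteristic of `K` prime to `l`" (no carrier in the §2 interface).
("`K ∋` primitive `l`-th root" = t2's `T.HasMuL`; "cusps rational" = `IsRationalCusp`.)
[cite: MochizukiEtTh2009, Cor 2.8 (ii) p.42] -/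
structure Cor28iiData (S : Subgroup T.Gtp) (A : Type u) [Group A] : Type u where
  /-- `μ_n(K) ⊆ (K^×)^∧` … -/
  mu : ℕ → Subgroup A
  /-- … inside `O_K^× ⊆ (K^×)^∧` (v2) -/
  units : Subgroup A
  mu_le : ∀ n, mu n ≤ units
  /-- the torsor structure at the cusp `g` -/
  torsor : ∀ g : T.Gtp, (T.cuspPairAt S g).TorsorData A
  /-- the canonical integral structure at the cusp `g`: an `O_K^×`-structure (v2 LAW, Def. 4.1 (iii)) -/
  canonical : ∀ g : T.Gtp, Set (T.cuspPairAt S g).SplittingClass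
  canonical_isStructure : ∀ g : T.Gtp, (torsor g).IsStructure units (canonical g)
  /-- FLAG "the residue characteristic of `K` is prime to `l`" (certified only by an origin predicate) -/
  ResCharPrimeToL : Prop

/-- **[EtTh] Cor. 2.8 (ii) for ONE member** `Z` (`Π^tp_Z = S`, Prop. 2.4 list `L`, root order `n`): under
the three hypotheses, at every `K`-rational cusp `g` there is a `μ_n`-structure `R g` compatible with the
canonical integral structure, and every automorphism `Γ` of `Π^tp_C` stabilising `L` (the extension of
`γ` by Prop. 2.4, as in t2's `Cor28_i`) carries `R g` onto `R g'` for the image cusp `g'`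
(`Γ(D_{z_g}) = D_{z_{g'}}`). [cite: MochizukiEtTh2009, Cor 2.8 (ii) p.42] -/
def Cor28iiAt (S : Subgroup T.Gtp) (L : List (Subgroup T.Gtp)) (n : ℕ) {A : Type u} [Group A]
    (𝒟 : T.Cor28iiData S A) : Prop :=
  T.HasMuL → 𝒟.ResCharPrimeToL → (∀ g, T.IsRationalCusp S g) →
    ∃ R : ∀ g : T.Gtp, Set (T.cuspPairAt S g).SplittingClass,
      (∀ g, (𝒟.torsor g).IsSubStructure (𝒟.mu n) (𝒟.canonical g) (R g)) ∧
      ∀ Γ : T.Gtp ≃ₜ* T.Gtp, (∀ S' ∈ L, S'.map Γ.toMulEquiv.toMonoidHom = S') →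
        ∀ g : T.Gtp, ∃ g' : T.Gtp,
          (T.cuspPairAt S g).PreservedBy (T.cuspPairAt S g') Γ (R g) (R g')

/-- **[EtTh] Cor. 2.8 (ii)** (p.268), the four cases in print order — `X̲̲` (`μ_{2l}`), `X̲` (`μ₂`),
`C̲̲` (`μ_{2l}`), `C̲` (`μ₂`) — each with its Prop. 2.4 list (t2's `Prop24`).
[cite: MochizukiEtTh2009, Cor 2.8 (ii) p.42] -/
def Cor28_ii {A : Type u} [Group A] (𝒟Xuu : T.Cor28iiData (T.tp T.PiXuu) A)
    (𝒟Xu : T.Cor28iiData (T.tp T.PiXu) A) (𝒟Cuu : T.Cor28iiData (T.tp T.PiCuu) A)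
    (𝒟Cu : T.Cor28iiData (T.tp T.PiCu) A) : Prop :=
  T.Cor28iiAt (T.tp T.PiXuu) T.tower (2 * l) 𝒟Xuu ∧
  T.Cor28iiAt (T.tp T.PiXu) [T.tp T.PiXu, T.tp T.PiX, T.PiYddtp] 2 𝒟Xu ∧
  T.Cor28iiAt (T.tp T.PiCuu) T.tower (2 * l) 𝒟Cuu ∧
  T.Cor28iiAt (T.tp T.PiCu) [T.tp T.PiCu, T.tp T.PiXu, T.tp T.PiX, T.PiYddtp] 2 𝒟Cu

/-- The cusp stabiliser of `Aut_K(Z)` **acts transitively** on the trivialisations `members (R)` at the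
cusp `g` (Rmk. 2.9.2, first sentence). [cite: MochizukiEtTh2009, Rmk 2.9.2 p.43] -/
def StabTransitive (S : Subgroup T.Gtp) (g : T.Gtp) (R : Set (T.cuspPairAt S g).SplittingClass) : Prop :=
  ∀ S₁ ∈ (T.cuspPairAt S g).members R, ∀ S₂ ∈ (T.cuspPairAt S g).members R,
    ∃ n ∈ T.cuspStabilizerReps S g, ∃ s ∈ S,
      MulAut.conj n • (T.cuspPairAt S g).D = MulAut.conj s • (T.cuspPairAt S g).D ∧
        T.stabAct n s S₁ = S₂

/-- At the cusp `g` the cusp stabiliser of `Aut_K(Z)` has **exactly two orbits** on `members (R)`, each the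
set of members of a `μ`-orbit of classes ("permutes the `2l` trivializations … via the action of `μ_l`
[hence has precisely two orbits]", Rmk. 2.9.2). [cite: MochizukiEtTh2009, Rmk 2.9.2 p.43] -/
def StabTwoMuOrbits (S : Subgroup T.Gtp) (g : T.Gtp) {A : Type u} [Group A]
    (𝒯 : (T.cuspPairAt S g).TorsorData A) (μ : Subgroup A)
    (R : Set (T.cuspPairAt S g).SplittingClass) : Prop :=
  ∃ R₁ R₂ : Set (T.cuspPairAt S g).SplittingClass, R = R₁ ∪ R₂ ∧ Disjoint R₁ R₂ ∧
    𝒯.IsStructure μ R₁ ∧ 𝒯.IsStructure μ R₂ ∧ T.StabTransitive S g R₁ ∧ T.StabTransitive S g R₂ ∧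
    ¬ T.StabTransitive S g R

/-- **[EtTh] Rmk. 2.9.2** (p.269) for `μ`-structures `RXuu`, `RXu` as produced by Cor. 2.8 (ii): (a) at a
cusp of `X̲̲` labelled `0` the cusp stabiliser of `Aut_K(X̲̲^log)` permutes the `2l` trivialisations
transitively; (b) at every cusp of `X̲` the stabiliser of `Aut_K(X̲^log)` permutes the `2`
trivialisations transitively; (c) at cusps of `X̲̲` with nonzero label it acts through `μ_l`, with exactly
two orbits.  The LABEL MAP of Cor. 2.9 is t2's TODO-merge (typed there as the cardinality `Cor29_card`);
it enters as the PARAMETER `label0` (the cusps `g` of `X̲̲` labelled `0`).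
[cite: MochizukiEtTh2009, Rmk 2.9.2 p.43] -/
def Rmk292 {A : Type u} [Group A] (𝒟Xuu : T.Cor28iiData (T.tp T.PiXuu) A)
    (RXuu : ∀ g, Set (T.cuspPairAt (T.tp T.PiXuu) g).SplittingClass)
    (RXu : ∀ g, Set (T.cuspPairAt (T.tp T.PiXu) g).SplittingClass) (label0 : Set T.Gtp) : Prop :=
  (∀ g ∈ label0, T.StabTransitive (T.tp T.PiXuu) g (RXuu g)) ∧
  (∀ g, T.StabTransitive (T.tp T.PiXu) g (RXu g)) ∧
  (∀ g, T.IsRationalCusp (T.tp T.PiXuu) g → g ∉ label0 →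
    T.StabTwoMuOrbits (T.tp T.PiXuu) g (𝒟Xuu.torsor g) (𝒟Xuu.mu l) (RXuu g))

end TemperedCoverData

end ThetaCovers

end Literature.AnabelianGeometry.EtaleTheta

end
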